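import Summits.Parity.GeneralizedHardyLittlewood.Theorems.PrimeLevelFamEdgeMomentsBeyondDiagonalDiagDecorShiftedCoord
import HarnessLib

/-!
# Route `PrimeLevelFamEdge`, crux K_A `MomentsBeyondDiagonal` (stmt-Parity-20007), line «petersson_layers» v4, stub `stub_diag`:
# **the SHIFTED BLOCK of the decorated Selberg form:
# `Sel(τ(k₁)ℓ⁺(k₁)^{r₁}·τ(k₂)ℓ⁺(k₂)^{r₂}·B^p) = (π²/6)²·(∫₀¹(λ−u)^p(u^{r₁}P)″(u^{r₂}P)″du)·log^{p+r₁+r₂+1}M/log⁴M + O(log^{p+r₁+r₂}M/log⁴M)`**,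
# `B = λlog M − log g − log(M/(cg))`, `ℓ⁺(k) = log((M/(cg))/k)` (the `β + ℓ⁺` scheme of `…DiagDecorShiftedCoord`)

Census R3(ii), ANALYTIC HALF. With `L = log(Q²/(n₁n₂)) = 2B + ℓ⁺(k₁) + ℓ⁺(k₂)` (`λ = log Q/log M`) every `L`-power weight
of the per-order targets is a binomial combination of these blocks:
`Sel(ττ·L^m) = Σ_{j≤m}Σ_{i≤j} C(m,j)C(j,i)2^{m−j}·Sel(τℓ⁺^{i}·τℓ⁺^{j−i}·B^{m−j})`. Here:

* `abs_collapseShifted_logPow_le` — the `(log g)^t` pieces (`t ≥ 1`) are one logarithm small: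
  `|Σ_cΣ_g μ(g)c(log g)^t W(cg)²·(λlog M − log(M/(cg)))^q𝒮^{[r₁]}(cg)𝒮^{[r₂]}(cg)| ≤ C·log^{t+q+r₁+r₂}M/log⁴M`
  (`…DiagDecorCollapseBounds.abs_selbergCollapse_logPow_le` + crude sizes + `Σ κD²/n ≪ log`);
* `selbergBlock_expand` — EXACT: `Sel(block) = Σ_{t≤p} C(p,t)(−1)^t·Σ_cΣ_g μ(g)c(log g)^t W(cg)²(λlog M − log(M/(cg)))^{p−t}𝒮^{[r₁]}𝒮^{[r₂]}`
  (`selbergInner_eq_W_sq_mul` + the binomial theorem for `B = (λlog M − log(M/(cg))) − log g`);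
* `abs_selbergBlock_sub_le` — **the block asymptotic displayed in the title** (`0 ≤ λ ≤ 1`, `P₀ = P₁ = 0`, `M ≥ 3`).

Def-free; theorems only. Helper `--supports stmt-Parity-20007`; closes nothing; K_A, K_B and the Parity summit are NOT
proved; nothing about Landau–Siegel zeros.

## References
* E. Kowalski, P. Michel, J. VanderKam, J. reine angew. Math. 526 (2000), (23)–(28) pp. 13–15 and Prop. 5.1 p. 18.
  [cite: KowalskiMichelVanderKam2000, (23)–(28) — derivation (diagonal main term in real Selberg coordinates)]
-/

noncomputable section

open scoped Real ArithmeticFunction.Moebius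
open Finset ArithmeticFunction Polynomial MeasureTheory intervalIntegral

namespace Summit.Parity.GeneralizedHardyLittlewood.Theorems.MomentsBeyondDiagonal.DiagKernel

open Literature.NumberTheory.LFunctions Literature.NumberTheory.LFunctions.KMV2000
open MollifierMainTerm (W)
open SelbergCoord (kappa)
open Literature.NumberTheory.Sieve (one_le_log_of_three_le)
open Summit.Parity.GeneralizedHardyLittlewood.Theorems.BeyondDiagonalBeatsQuarter.KernelFormXSq
  (mainConst divWeight divWeight_nonneg mainConst_nonneg abs_W_le totient_mul_W_sq_le sum_divWeight_sq_div_le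
    sum_kappa_divWeight_sq_div_le)

/-- `κ(n) ≥ 0`. [folklore] -/
private theorem kappa_nonneg'' (n : ℕ) : 0 ≤ kappa n := by
  unfold kappa
  exact Finset.sum_nonneg fun p hp ↦ by
    have hp2 : (2 : ℝ) ≤ p := by exact_mod_cast (Nat.prime_of_mem_primeFactors hp).two_le
    exact div_nonneg (Real.log_nonneg (by linarith)) (by linarith)

/-- `|λlog M − log(M/n)| ≤ log M` for `0 ≤ λ ≤ 1`, `M ≥ 3`, `1 ≤ n ≤ M`. [folklore] -/
theorem abs_lam_mul_log_sub_log_div_le {lam : ℝ} (hlam0 : 0 ≤ lam) (hlam1 : lam ≤ 1) {M : ℝ} (hM : 3 ≤ M)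
    {n : ℕ} (hn : n ≠ 0) (hnM : (n : ℝ) ≤ M) :
    |lam * Real.log M - Real.log (M / n)| ≤ Real.log M := by
  obtain ⟨hY0, hYℓ⟩ := log_div_nonneg_and_le hM hn hnM
  have hℓ0 : 0 ≤ Real.log M := by linarith
  have h1 : lam * Real.log M ≤ Real.log M := by nlinarith
  have h2 : 0 ≤ lam * Real.log M := mul_nonneg hlam0 hℓ0
  rw [abs_le]; constructor <;> linarith

/-! ### The `(log g)^t` pieces are small -/

/-- **The `(log g)^t` pieces of a shifted block are one logarithm small** (`t ≥ 1`, `0 ≤ λ ≤ 1`, `P₀ = P₁ = 0`):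
`|Σ_cΣ_g μ(g)c(log g)^t W(cg)²(λlog M − log(M/(cg)))^q𝒮^{[r₁]}(cg)𝒮^{[r₂]}(cg)| ≤ C·log^{t+q+r₁+r₂}M/log⁴M` for `M ≥ 3`.
[cite: KowalskiMichelVanderKam2000, (23)–(28) — derivation (log g terms of the diagonal main term)] -/
theorem abs_collapseShifted_logPow_le (P : ℝ[X]) (hP0 : P.coeff 0 = 0) (hP1 : P.coeff 1 = 0) {t : ℕ} (ht : 1 ≤ t)
    (q r₁ r₂ : ℕ) {lam : ℝ} (hlam0 : 0 ≤ lam) (hlam1 : lam ≤ 1) :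
    ∃ C : ℝ, 0 < C ∧ ∀ M : ℝ, 3 ≤ M →
      |∑ c ∈ Icc 1 ⌊M⌋₊, ∑ g ∈ Icc 1 (⌊M⌋₊ / c), (μ g : ℝ) * c * Real.log g ^ t * (W (c * g) ^ 2 *
          ((lam * Real.log M - Real.log (M / ((c * g : ℕ) : ℝ))) ^ q *
            (∑ c' ∈ Finset.range (P.natDegree + 1), P.coeff c' *
              ((∑ k ∈ Icc 1 ⌊M / ((c * g : ℕ) : ℝ)⌋₊, (if k.Coprime (c * g) then W k else 0) * (k.divisors.card : ℝ) *
                Real.log (M / ((c * g : ℕ) : ℝ) / k) ^ (c' + r₁)) / Real.log M ^ c')) *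
            (∑ c' ∈ Finset.range (P.natDegree + 1), P.coeff c' *
              ((∑ k ∈ Icc 1 ⌊M / ((c * g : ℕ) : ℝ)⌋₊, (if k.Coprime (c * g) then W k else 0) * (k.divisors.card : ℝ) *
                Real.log (M / ((c * g : ℕ) : ℝ) / k) ^ (c' + r₂)) / Real.log M ^ c'))))| ≤
        C * Real.log M ^ (t + q + r₁ + r₂) / Real.log M ^ 4 := by
  obtain ⟨K₁, hK₁, hb₁⟩ := abs_shiftedCoord_le P hP0 hP1 r₁
  obtain ⟨K₂, hK₂, hb₂⟩ := abs_shiftedCoord_le P hP0 hP1 r₂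
  set S₁ : ℝ → ℕ → ℝ := fun M n ↦ ∑ c' ∈ Finset.range (P.natDegree + 1), P.coeff c' *
    ((∑ k ∈ Icc 1 ⌊M / n⌋₊, (if k.Coprime n then W k else 0) * (k.divisors.card : ℝ) *
      Real.log (M / n / k) ^ (c' + r₁)) / Real.log M ^ c') with hS₁
  set S₂ : ℝ → ℕ → ℝ := fun M n ↦ ∑ c' ∈ Finset.range (P.natDegree + 1), P.coeff c' *
    ((∑ k ∈ Icc 1 ⌊M / n⌋₊, (if k.Coprime n then W k else 0) * (k.divisors.card : ℝ) *
      Real.log (M / n / k) ^ (c' + r₂)) / Real.log M ^ c') with hS₂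
  set A : ℝ := (∑' d : ℕ, (d : ℝ) ^ (-(5 / 4 : ℝ))) ^ 2 with hA
  have hA0 : 0 ≤ A := by positivity
  refine ⟨K₁ * K₂ * (48 * A * 3) + 1, by positivity, fun M hM ↦ ?_⟩
  set ℓ := Real.log M with hℓ
  have hℓ1 : 1 ≤ ℓ := one_le_log_of_three_le hM
  have hℓ0 : 0 < ℓ := by linarith
  have hM0 : 0 < M := by linarith
  set N := ⌊M⌋₊ with hN
  have hN1 : 1 ≤ N := Nat.le_floor (by norm_num; linarith)
  have hlogN : Real.log N ≤ ℓ := Real.log_le_log (by exact_mod_cast hN1) (Nat.floor_le hM0.le)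
  have hlogN0 : 0 ≤ Real.log N := Real.log_natCast_nonneg N
  set F : ℕ → ℝ := fun n ↦ (lam * ℓ - Real.log (M / n)) ^ q * S₁ M n * S₂ M n with hF
  have hre : ∑ c ∈ Icc 1 N, ∑ g ∈ Icc 1 (N / c), (μ g : ℝ) * c * Real.log g ^ t * (W (c * g) ^ 2 *
      ((lam * ℓ - Real.log (M / ((c * g : ℕ) : ℝ))) ^ q * S₁ M (c * g) * S₂ M (c * g))) =
      ∑ c ∈ Icc 1 N, ∑ g ∈ Icc 1 (N / c), (μ g : ℝ) * c * Real.log g ^ t * (W (c * g) ^ 2 * F (c * g)) := by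
    rfl
  have hgoal : |∑ c ∈ Icc 1 N, ∑ g ∈ Icc 1 (N / c), (μ g : ℝ) * c * Real.log g ^ t * (W (c * g) ^ 2 *
      ((lam * ℓ - Real.log (M / ((c * g : ℕ) : ℝ))) ^ q * S₁ M (c * g) * S₂ M (c * g)))| ≤
      (K₁ * K₂ * (48 * A * 3) + 1) * ℓ ^ (t + q + r₁ + r₂) / ℓ ^ 4 := by
    rw [hre]
    refine (abs_selbergCollapse_logPow_le ht N F).trans ?_
    have hterm : ∀ n ∈ Icc 1 N, |W n| * kappa n * |F n| ≤
        K₁ * K₂ * ℓ ^ (q + r₁ + r₂) / ℓ ^ 4 * (kappa n * divWeight n ^ 2 / n) := by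
      intro n hn
      have hn' := Finset.mem_Icc.1 hn
      have hn0 : n ≠ 0 := by omega
      have hnM : (n : ℝ) ≤ M := le_trans (by exact_mod_cast hn'.2) (Nat.floor_le hM0.le)
      have hD := divWeight_nonneg n
      have hκ := kappa_nonneg'' n
      have hW := abs_W_le n
      have hB : |(lam * ℓ - Real.log (M / n)) ^ q| ≤ ℓ ^ q := by
        rw [abs_pow]; exact pow_le_pow_left₀ (abs_nonneg _) (abs_lam_mul_log_sub_log_div_le hlam0 hlam1 hM hn0 hnM) q
      have hS := mul_le_mul (hb₁ M hM n hn0 hnM) (hb₂ M hM n hn0 hnM) (abs_nonneg _) (by positivity)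
      have hF' : |F n| ≤ ℓ ^ q * (K₁ * divWeight n * ℓ ^ r₁ / ℓ ^ 2 * (K₂ * divWeight n * ℓ ^ r₂ / ℓ ^ 2)) := by
        simp only [hF]
        rw [abs_mul, abs_mul, mul_assoc]
        exact mul_le_mul hB hS (by positivity) (by positivity)
      have hn0' : (0 : ℝ) < n := by exact_mod_cast Nat.pos_of_ne_zero hn0
      calc |W n| * kappa n * |F n|
          ≤ (n : ℝ)⁻¹ * kappa n * (ℓ ^ q * (K₁ * divWeight n * ℓ ^ r₁ / ℓ ^ 2 * (K₂ * divWeight n * ℓ ^ r₂ / ℓ ^ 2))) := by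
            gcongr
        _ = K₁ * K₂ * ℓ ^ (q + r₁ + r₂) / ℓ ^ 4 * (kappa n * divWeight n ^ 2 / n) := by
            rw [pow_add, pow_add]; field_simp
    have hsum : ∑ n ∈ Icc 1 N, |W n| * kappa n * |F n| ≤
        K₁ * K₂ * ℓ ^ (q + r₁ + r₂) / ℓ ^ 4 * (48 * A * (3 * ℓ)) := by
      calc _ ≤ ∑ n ∈ Icc 1 N, K₁ * K₂ * ℓ ^ (q + r₁ + r₂) / ℓ ^ 4 * (kappa n * divWeight n ^ 2 / n) :=
            Finset.sum_le_sum hterm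
        _ = K₁ * K₂ * ℓ ^ (q + r₁ + r₂) / ℓ ^ 4 * ∑ n ∈ Icc 1 N, kappa n * divWeight n ^ 2 / n := by
            rw [Finset.mul_sum]
        _ ≤ K₁ * K₂ * ℓ ^ (q + r₁ + r₂) / ℓ ^ 4 * (48 * A * (2 + Real.log N)) := by
            refine mul_le_mul_of_nonneg_left ?_ (by positivity)
            have := sum_kappa_divWeight_sq_div_le hN1
            rw [← hA] at this
            exact this
        _ ≤ K₁ * K₂ * ℓ ^ (q + r₁ + r₂) / ℓ ^ 4 * (48 * A * (3 * ℓ)) := by gcongr; linarith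
    have hpow : Real.log N ^ (t - 1) ≤ ℓ ^ (t - 1) := pow_le_pow_left₀ hlogN0 hlogN _
    have hsum0 : 0 ≤ ∑ n ∈ Icc 1 N, |W n| * kappa n * |F n| :=
      Finset.sum_nonneg fun n _ ↦ by have := kappa_nonneg'' n; positivity
    calc Real.log N ^ (t - 1) * ∑ n ∈ Icc 1 N, |W n| * kappa n * |F n|
        ≤ ℓ ^ (t - 1) * (K₁ * K₂ * ℓ ^ (q + r₁ + r₂) / ℓ ^ 4 * (48 * A * (3 * ℓ))) :=
          mul_le_mul hpow hsum hsum0 (by positivity)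
      _ = K₁ * K₂ * (48 * A * 3) * (ℓ ^ (t - 1) * ℓ * ℓ ^ (q + r₁ + r₂)) / ℓ ^ 4 := by ring
      _ = K₁ * K₂ * (48 * A * 3) * ℓ ^ (t + q + r₁ + r₂) / ℓ ^ 4 := by
          rw [pow_sub_one_mul (by omega : t ≠ 0) ℓ, ← pow_add, show t + (q + r₁ + r₂) = t + q + r₁ + r₂ by ring]
      _ ≤ (K₁ * K₂ * (48 * A * 3) + 1) * ℓ ^ (t + q + r₁ + r₂) / ℓ ^ 4 := by gcongr; linarith
  simpa only [hS₁, hS₂] using hgoal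

/-! ### The shifted block: exact expansion and asymptotic -/

/-- Binomial bookkeeping: `μ(g)c·(a − log g)^p·(x(y₁y₂)) = Σ_t C(p,t)(−1)^t·(μ(g)c(log g)^t·(x(a^{p−t}y₁y₂)))`. [folklore] -/
private theorem moebius_mul_sub_log_pow_eq (g : ℕ) (cc a x y₁ y₂ : ℝ) (p : ℕ) :
    (μ g : ℝ) * cc * ((a - Real.log g) ^ p * (x * (y₁ * y₂))) =
      ∑ t ∈ Finset.range (p + 1), (p.choose t : ℝ) * (-1) ^ t *
        ((μ g : ℝ) * cc * Real.log g ^ t * (x * (a ^ (p - t) * y₁ * y₂))) := by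
  rw [show a - Real.log g = -Real.log g + a by ring, add_pow, Finset.sum_mul, Finset.mul_sum]
  refine Finset.sum_congr rfl fun t _ ↦ ?_
  rw [neg_pow]
  ring

/-- Assembly bookkeeping: `|Σ_{t≤p}F(t) − main| ≤ (C₀ + Σ_{t<p}K(t+1))·X` from `|F 0 − main| ≤ C₀X`, `|F(t+1)| ≤ K(t+1)X`. [folklore] -/
private theorem abs_sum_range_succ_sub_le {p : ℕ} (F : ℕ → ℝ) (main X C₀ : ℝ) (K : ℕ → ℝ)
    (h0 : |F 0 - main| ≤ C₀ * X) (hK : ∀ t ∈ Finset.range p, |F (t + 1)| ≤ K (t + 1) * X) :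
    |∑ t ∈ Finset.range (p + 1), F t - main| ≤ (C₀ + ∑ t ∈ Finset.range p, K (t + 1)) * X := by
  rw [Finset.sum_range_succ', show ∑ t ∈ Finset.range p, F (t + 1) + F 0 - main =
    (F 0 - main) + ∑ t ∈ Finset.range p, F (t + 1) by ring]
  calc _ ≤ |F 0 - main| + |∑ t ∈ Finset.range p, F (t + 1)| := abs_add_le _ _
    _ ≤ C₀ * X + ∑ t ∈ Finset.range p, K (t + 1) * X :=
        add_le_add h0 ((Finset.abs_sum_le_sum_abs _ _).trans (Finset.sum_le_sum hK))
    _ = (C₀ + ∑ t ∈ Finset.range p, K (t + 1)) * X := by rw [← Finset.sum_mul]; ring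

/-- **Exact expansion of a shifted block** along `B = (λlog M − log(M/(cg))) − log g`:
`Sel(τℓ⁺^{r₁}·τℓ⁺^{r₂}·B^p) = Σ_{t≤p} C(p,t)(−1)^t Σ_cΣ_g μ(g)c(log g)^t·W(cg)²(λlog M − log(M/(cg)))^{p−t}𝒮^{[r₁]}(cg)𝒮^{[r₂]}(cg)`.
[cite: KowalskiMichelVanderKam2000, (23) — derivation] -/
theorem selbergBlock_expand (P : ℝ[X]) (M lam : ℝ) (p r₁ r₂ : ℕ) :
    ∑ c ∈ Icc 1 ⌊M⌋₊, ∑ g ∈ Icc 1 (⌊M⌋₊ / c), (μ g : ℝ) * c *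
        ∑ k₁ ∈ Icc 1 (⌊M⌋₊ / (c * g)), ∑ k₂ ∈ Icc 1 (⌊M⌋₊ / (c * g)),
          ((μ (c * g * k₁) : ℝ) * ((psi (c * g * k₁))⁻¹ *
              P.eval (Real.log (M / ((c * g * k₁ : ℕ) : ℝ)) / Real.log M))) / ((c * g * k₁ : ℕ) : ℝ) *
            (((μ (c * g * k₂) : ℝ) * ((psi (c * g * k₂))⁻¹ *
              P.eval (Real.log (M / ((c * g * k₂ : ℕ) : ℝ)) / Real.log M))) / ((c * g * k₂ : ℕ) : ℝ)) *
            (((k₁.divisors.card : ℝ) * Real.log (M / ((c * g : ℕ) : ℝ) / k₁) ^ r₁) *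
              ((k₂.divisors.card : ℝ) * Real.log (M / ((c * g : ℕ) : ℝ) / k₂) ^ r₂) *
              (lam * Real.log M - Real.log g - Real.log (M / ((c * g : ℕ) : ℝ))) ^ p) =
      ∑ t ∈ Finset.range (p + 1), (p.choose t : ℝ) * (-1) ^ t *
        ∑ c ∈ Icc 1 ⌊M⌋₊, ∑ g ∈ Icc 1 (⌊M⌋₊ / c), (μ g : ℝ) * c * Real.log g ^ t * (W (c * g) ^ 2 *
          ((lam * Real.log M - Real.log (M / ((c * g : ℕ) : ℝ))) ^ (p - t) *
            (∑ c' ∈ Finset.range (P.natDegree + 1), P.coeff c' *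
              ((∑ k ∈ Icc 1 ⌊M / ((c * g : ℕ) : ℝ)⌋₊, (if k.Coprime (c * g) then W k else 0) * (k.divisors.card : ℝ) *
                Real.log (M / ((c * g : ℕ) : ℝ) / k) ^ (c' + r₁)) / Real.log M ^ c')) *
            (∑ c' ∈ Finset.range (P.natDegree + 1), P.coeff c' *
              ((∑ k ∈ Icc 1 ⌊M / ((c * g : ℕ) : ℝ)⌋₊, (if k.Coprime (c * g) then W k else 0) * (k.divisors.card : ℝ) *
                Real.log (M / ((c * g : ℕ) : ℝ) / k) ^ (c' + r₂)) / Real.log M ^ c')))) := by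
  -- notation for the shifted coordinates
  set S₁ : ℕ → ℝ := fun n ↦ ∑ c' ∈ Finset.range (P.natDegree + 1), P.coeff c' *
    ((∑ k ∈ Icc 1 ⌊M / n⌋₊, (if k.Coprime n then W k else 0) * (k.divisors.card : ℝ) *
      Real.log (M / n / k) ^ (c' + r₁)) / Real.log M ^ c') with hS₁
  set S₂ : ℕ → ℝ := fun n ↦ ∑ c' ∈ Finset.range (P.natDegree + 1), P.coeff c' *
    ((∑ k ∈ Icc 1 ⌊M / n⌋₊, (if k.Coprime n then W k else 0) * (k.divisors.card : ℝ) *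
      Real.log (M / n / k) ^ (c' + r₂)) / Real.log M ^ c') with hS₂
  -- Step 1: the inner double `k`-sum factors, for each `(c, g)`
  have hinner : ∀ c ∈ Icc 1 ⌊M⌋₊, ∀ g ∈ Icc 1 (⌊M⌋₊ / c),
      ∑ k₁ ∈ Icc 1 (⌊M⌋₊ / (c * g)), ∑ k₂ ∈ Icc 1 (⌊M⌋₊ / (c * g)),
          ((μ (c * g * k₁) : ℝ) * ((psi (c * g * k₁))⁻¹ *
              P.eval (Real.log (M / ((c * g * k₁ : ℕ) : ℝ)) / Real.log M))) / ((c * g * k₁ : ℕ) : ℝ) *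
            (((μ (c * g * k₂) : ℝ) * ((psi (c * g * k₂))⁻¹ *
              P.eval (Real.log (M / ((c * g * k₂ : ℕ) : ℝ)) / Real.log M))) / ((c * g * k₂ : ℕ) : ℝ)) *
            (((k₁.divisors.card : ℝ) * Real.log (M / ((c * g : ℕ) : ℝ) / k₁) ^ r₁) *
              ((k₂.divisors.card : ℝ) * Real.log (M / ((c * g : ℕ) : ℝ) / k₂) ^ r₂) *
              (lam * Real.log M - Real.log g - Real.log (M / ((c * g : ℕ) : ℝ))) ^ p) =
        (lam * Real.log M - Real.log g - Real.log (M / ((c * g : ℕ) : ℝ))) ^ p *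
          (W (c * g) ^ 2 * (S₁ (c * g) * S₂ (c * g))) := by
    intro c hc g hg
    have hc0 : c ≠ 0 := by have := (Finset.mem_Icc.1 hc).1; omega
    have hg0 : g ≠ 0 := by have := (Finset.mem_Icc.1 hg).1; omega
    set Bp := (lam * Real.log M - Real.log g - Real.log (M / ((c * g : ℕ) : ℝ))) ^ p with hBp
    set t₁ : ℕ → ℝ := fun k ↦ (k.divisors.card : ℝ) * Real.log (M / ((c * g : ℕ) : ℝ) / k) ^ r₁ with ht₁
    set t₂ : ℕ → ℝ := fun k ↦ (k.divisors.card : ℝ) * Real.log (M / ((c * g : ℕ) : ℝ) / k) ^ r₂ * Bp with ht₂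
    have h := selbergInner_eq_W_sq_mul P M (mul_ne_zero hc0 hg0) t₁ t₂
    have hre : ∑ k₁ ∈ Icc 1 (⌊M⌋₊ / (c * g)), ∑ k₂ ∈ Icc 1 (⌊M⌋₊ / (c * g)),
        ((μ (c * g * k₁) : ℝ) * ((psi (c * g * k₁))⁻¹ *
            P.eval (Real.log (M / ((c * g * k₁ : ℕ) : ℝ)) / Real.log M))) / ((c * g * k₁ : ℕ) : ℝ) *
          (((μ (c * g * k₂) : ℝ) * ((psi (c * g * k₂))⁻¹ *
            P.eval (Real.log (M / ((c * g * k₂ : ℕ) : ℝ)) / Real.log M))) / ((c * g * k₂ : ℕ) : ℝ)) *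
          (((k₁.divisors.card : ℝ) * Real.log (M / ((c * g : ℕ) : ℝ) / k₁) ^ r₁) *
            ((k₂.divisors.card : ℝ) * Real.log (M / ((c * g : ℕ) : ℝ) / k₂) ^ r₂) * Bp) =
        ∑ k₁ ∈ Icc 1 (⌊M⌋₊ / (c * g)), ∑ k₂ ∈ Icc 1 (⌊M⌋₊ / (c * g)),
        ((μ (c * g * k₁) : ℝ) * ((psi (c * g * k₁))⁻¹ *
            P.eval (Real.log (M / ((c * g * k₁ : ℕ) : ℝ)) / Real.log M))) / ((c * g * k₁ : ℕ) : ℝ) *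
          (((μ (c * g * k₂) : ℝ) * ((psi (c * g * k₂))⁻¹ *
            P.eval (Real.log (M / ((c * g * k₂ : ℕ) : ℝ)) / Real.log M))) / ((c * g * k₂ : ℕ) : ℝ)) *
          (t₁ k₁ * t₂ k₂) :=
      Finset.sum_congr rfl fun k₁ _ ↦ Finset.sum_congr rfl fun k₂ _ ↦ by simp only [ht₁, ht₂]; ring
    rw [hre, h]
    -- identify the two coordinates
    have h1 : ∑ c' ∈ Finset.range (P.natDegree + 1), P.coeff c' *
        ((∑ k ∈ Icc 1 ⌊M / ((c * g : ℕ) : ℝ)⌋₊, (if k.Coprime (c * g) then W k else 0) * t₁ k *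
          Real.log (M / ((c * g : ℕ) : ℝ) / k) ^ c') / Real.log M ^ c') = S₁ (c * g) := by
      simp only [hS₁, ht₁]
      refine Finset.sum_congr rfl fun c' _ ↦ ?_
      congr 1; congr 1
      refine Finset.sum_congr rfl fun k _ ↦ ?_
      rw [pow_add]; ring
    have h2 : ∑ c' ∈ Finset.range (P.natDegree + 1), P.coeff c' *
        ((∑ k ∈ Icc 1 ⌊M / ((c * g : ℕ) : ℝ)⌋₊, (if k.Coprime (c * g) then W k else 0) * t₂ k *
          Real.log (M / ((c * g : ℕ) : ℝ) / k) ^ c') / Real.log M ^ c') = Bp * S₂ (c * g) := by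
      simp only [hS₂, ht₂]
      rw [Finset.mul_sum]
      refine Finset.sum_congr rfl fun c' _ ↦ ?_
      have hk : ∑ k ∈ Icc 1 ⌊M / ((c * g : ℕ) : ℝ)⌋₊, (if k.Coprime (c * g) then W k else 0) *
          ((k.divisors.card : ℝ) * Real.log (M / ((c * g : ℕ) : ℝ) / k) ^ r₂ * Bp) *
            Real.log (M / ((c * g : ℕ) : ℝ) / k) ^ c' =
          Bp * ∑ k ∈ Icc 1 ⌊M / ((c * g : ℕ) : ℝ)⌋₊, (if k.Coprime (c * g) then W k else 0) *
            (k.divisors.card : ℝ) * Real.log (M / ((c * g : ℕ) : ℝ) / k) ^ (c' + r₂) := by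
        rw [Finset.mul_sum]
        exact Finset.sum_congr rfl fun k _ ↦ by rw [pow_add]; ring
      rw [hk]; ring
    rw [h1, h2]; ring
  rw [Finset.sum_congr rfl fun c hc ↦ Finset.sum_congr rfl fun g hg ↦ congrArg _ (hinner c hc g hg)]
  -- Step 2: binomial expansion of `B^p` for each `(c,g)` and exchange of summations
  have hstep : ∀ c g : ℕ, (μ g : ℝ) * c * ((lam * Real.log M - Real.log g - Real.log (M / ((c * g : ℕ) : ℝ))) ^ p *
      (W (c * g) ^ 2 * (S₁ (c * g) * S₂ (c * g)))) =
      ∑ t ∈ Finset.range (p + 1), (p.choose t : ℝ) * (-1) ^ t *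
        ((μ g : ℝ) * c * Real.log g ^ t * (W (c * g) ^ 2 *
          ((lam * Real.log M - Real.log (M / ((c * g : ℕ) : ℝ))) ^ (p - t) * S₁ (c * g) * S₂ (c * g)))) := by
    intro c g
    rw [show lam * Real.log M - Real.log g - Real.log (M / ((c * g : ℕ) : ℝ)) =
      (lam * Real.log M - Real.log (M / ((c * g : ℕ) : ℝ))) - Real.log g by ring]
    exact moebius_mul_sub_log_pow_eq g c _ (W (c * g) ^ 2) (S₁ (c * g)) (S₂ (c * g)) p
  rw [Finset.sum_congr rfl fun c _ ↦ Finset.sum_congr rfl fun g _ ↦ hstep c g]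
  rw [Finset.sum_congr rfl fun c _ ↦ Finset.sum_comm, Finset.sum_comm]
  refine Finset.sum_congr rfl fun t _ ↦ ?_
  rw [Finset.mul_sum (Icc 1 ⌊M⌋₊)]
  refine Finset.sum_congr rfl fun c _ ↦ ?_
  rw [Finset.mul_sum (Icc 1 (⌊M⌋₊ / c))]

/-- **THE SHIFTED BLOCK ASYMPTOTIC**: for `0 ≤ λ ≤ 1`, `P₀ = P₁ = 0` and all `p, r₁, r₂` there is `C` with, for `M ≥ 3`,
`|Sel(τℓ⁺^{r₁}·τℓ⁺^{r₂}·B^p) − (π²/6)²(∫₀¹(λ−u)^p(u^{r₁}P)″(u^{r₂}P)″)·log^{p+r₁+r₂}M·log M/log⁴M| ≤ C·log^{p+r₁+r₂}M/log⁴M`.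
[cite: KowalskiMichelVanderKam2000, (23)–(28) and Prop. 5.1 — derivation (diagonal main term in real Selberg coordinates)] -/
theorem abs_selbergBlock_sub_le (P : ℝ[X]) (hP0 : P.coeff 0 = 0) (hP1 : P.coeff 1 = 0) (p r₁ r₂ : ℕ)
    {lam : ℝ} (hlam0 : 0 ≤ lam) (hlam1 : lam ≤ 1) :
    ∃ C : ℝ, 0 < C ∧ ∀ M : ℝ, 3 ≤ M →
      |∑ c ∈ Icc 1 ⌊M⌋₊, ∑ g ∈ Icc 1 (⌊M⌋₊ / c), (μ g : ℝ) * c *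
          ∑ k₁ ∈ Icc 1 (⌊M⌋₊ / (c * g)), ∑ k₂ ∈ Icc 1 (⌊M⌋₊ / (c * g)),
            ((μ (c * g * k₁) : ℝ) * ((psi (c * g * k₁))⁻¹ *
                P.eval (Real.log (M / ((c * g * k₁ : ℕ) : ℝ)) / Real.log M))) / ((c * g * k₁ : ℕ) : ℝ) *
              (((μ (c * g * k₂) : ℝ) * ((psi (c * g * k₂))⁻¹ *
                P.eval (Real.log (M / ((c * g * k₂ : ℕ) : ℝ)) / Real.log M))) / ((c * g * k₂ : ℕ) : ℝ)) *
              (((k₁.divisors.card : ℝ) * Real.log (M / ((c * g : ℕ) : ℝ) / k₁) ^ r₁) *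
                ((k₂.divisors.card : ℝ) * Real.log (M / ((c * g : ℕ) : ℝ) / k₂) ^ r₂) *
                (lam * Real.log M - Real.log g - Real.log (M / ((c * g : ℕ) : ℝ))) ^ p) -
        (π ^ 2 / 6) ^ 2 * (∫ u in (0 : ℝ)..1,
            (((Polynomial.C lam - X) ^ p * derivative (derivative (X ^ r₁ * P))) *
              derivative (derivative (X ^ r₂ * P))).eval u) *
          Real.log M ^ (p + r₁ + r₂) * Real.log M / Real.log M ^ 4| ≤
        C * Real.log M ^ (p + r₁ + r₂) / Real.log M ^ 4 := by
  -- constants: main piece `t = 0` and the `(log g)^t` pieces `t ≥ 1`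
  obtain ⟨C₀, hC₀, h0⟩ := abs_harmonicShifted_sub_le P hP0 hP1 p r₁ r₂ hlam0 hlam1
  have hex : ∀ t : ℕ, ∃ C : ℝ, 0 < C ∧ (1 ≤ t → ∀ M : ℝ, 3 ≤ M →
      |∑ c ∈ Icc 1 ⌊M⌋₊, ∑ g ∈ Icc 1 (⌊M⌋₊ / c), (μ g : ℝ) * c * Real.log g ^ t * (W (c * g) ^ 2 *
          ((lam * Real.log M - Real.log (M / ((c * g : ℕ) : ℝ))) ^ (p - t) *
            (∑ c' ∈ Finset.range (P.natDegree + 1), P.coeff c' *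
              ((∑ k ∈ Icc 1 ⌊M / ((c * g : ℕ) : ℝ)⌋₊, (if k.Coprime (c * g) then W k else 0) * (k.divisors.card : ℝ) *
                Real.log (M / ((c * g : ℕ) : ℝ) / k) ^ (c' + r₁)) / Real.log M ^ c')) *
            (∑ c' ∈ Finset.range (P.natDegree + 1), P.coeff c' *
              ((∑ k ∈ Icc 1 ⌊M / ((c * g : ℕ) : ℝ)⌋₊, (if k.Coprime (c * g) then W k else 0) * (k.divisors.card : ℝ) *
                Real.log (M / ((c * g : ℕ) : ℝ) / k) ^ (c' + r₂)) / Real.log M ^ c'))))| ≤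
        C * Real.log M ^ (t + (p - t) + r₁ + r₂) / Real.log M ^ 4) := by
    intro t
    by_cases ht : 1 ≤ t
    · obtain ⟨C, hC, h⟩ := abs_collapseShifted_logPow_le P hP0 hP1 ht (p - t) r₁ r₂ hlam0 hlam1
      exact ⟨C, hC, fun _ ↦ h⟩
    · exact ⟨1, one_pos, fun h ↦ absurd h ht⟩
  choose Ct hCt0 hCt using hex
  have hKsum : 0 ≤ ∑ t ∈ Finset.range p, (p.choose (t + 1) : ℝ) * Ct (t + 1) :=
    Finset.sum_nonneg fun t _ ↦ by have := hCt0 (t + 1); positivity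
  refine ⟨C₀ + ∑ t ∈ Finset.range p, (p.choose (t + 1) : ℝ) * Ct (t + 1), by positivity, fun M hM ↦ ?_⟩
  have hℓ1 : 1 ≤ Real.log M := one_le_log_of_three_le hM
  have hℓpos : 0 < Real.log M := by linarith
  set Xe : ℝ := Real.log M ^ (p + r₁ + r₂) / Real.log M ^ 4 with hXe
  rw [selbergBlock_expand P M lam p r₁ r₂]
  refine (abs_sum_range_succ_sub_le _ _ Xe C₀ (fun t ↦ (p.choose t : ℝ) * Ct t) ?_ (fun t ht ↦ ?_)).trans_eq
    (by rw [hXe]; ring)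
  · -- the `t = 0` piece is the harmonic sum of `…DiagDecorShiftedCoord`
    have h0' := h0 M hM
    simp only [Nat.choose_zero_right, Nat.cast_one, pow_zero, mul_one, one_mul, Nat.sub_zero]
    rw [selbergCollapse_zero ⌊M⌋₊ (fun n ↦ W n ^ 2 * ((lam * Real.log M - Real.log (M / n)) ^ p *
      (∑ c ∈ Finset.range (P.natDegree + 1), P.coeff c *
        ((∑ k ∈ Icc 1 ⌊M / n⌋₊, (if k.Coprime n then W k else 0) * (k.divisors.card : ℝ) *
          Real.log (M / n / k) ^ (c + r₁)) / Real.log M ^ c)) *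
      (∑ c ∈ Finset.range (P.natDegree + 1), P.coeff c *
        ((∑ k ∈ Icc 1 ⌊M / n⌋₊, (if k.Coprime n then W k else 0) * (k.divisors.card : ℝ) *
          Real.log (M / n / k) ^ (c + r₂)) / Real.log M ^ c))))]
    have hre : ∑ n ∈ Icc 1 ⌊M⌋₊, (Nat.totient n : ℝ) * (W n ^ 2 * ((lam * Real.log M - Real.log (M / n)) ^ p *
        (∑ c ∈ Finset.range (P.natDegree + 1), P.coeff c *
          ((∑ k ∈ Icc 1 ⌊M / n⌋₊, (if k.Coprime n then W k else 0) * (k.divisors.card : ℝ) *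
            Real.log (M / n / k) ^ (c + r₁)) / Real.log M ^ c)) *
        (∑ c ∈ Finset.range (P.natDegree + 1), P.coeff c *
          ((∑ k ∈ Icc 1 ⌊M / n⌋₊, (if k.Coprime n then W k else 0) * (k.divisors.card : ℝ) *
            Real.log (M / n / k) ^ (c + r₂)) / Real.log M ^ c)))) =
        ∑ n ∈ Icc 1 ⌊M⌋₊, (Nat.totient n : ℝ) * W n ^ 2 * ((lam * Real.log M - Real.log (M / n)) ^ p *
        (∑ c ∈ Finset.range (P.natDegree + 1), P.coeff c *
          ((∑ k ∈ Icc 1 ⌊M / n⌋₊, (if k.Coprime n then W k else 0) * (k.divisors.card : ℝ) *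
            Real.log (M / n / k) ^ (c + r₁)) / Real.log M ^ c)) *
        (∑ c ∈ Finset.range (P.natDegree + 1), P.coeff c *
          ((∑ k ∈ Icc 1 ⌊M / n⌋₊, (if k.Coprime n then W k else 0) * (k.divisors.card : ℝ) *
            Real.log (M / n / k) ^ (c + r₂)) / Real.log M ^ c))) :=
      Finset.sum_congr rfl fun n _ ↦ by ring
    rw [hre, hXe, ← mul_div_assoc]
    exact h0'
  · -- the `(log g)^{t+1}` pieces
    have htp : t < p := Finset.mem_range.1 ht
    have h := hCt (t + 1) (by omega) M hM
    have e : t + 1 + (p - (t + 1)) + r₁ + r₂ = p + r₁ + r₂ := by omega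
    rw [e] at h
    have h' : |∑ c ∈ Icc 1 ⌊M⌋₊, ∑ g ∈ Icc 1 (⌊M⌋₊ / c), (μ g : ℝ) * c * Real.log g ^ (t + 1) * (W (c * g) ^ 2 *
          ((lam * Real.log M - Real.log (M / ((c * g : ℕ) : ℝ))) ^ (p - (t + 1)) *
            (∑ c' ∈ Finset.range (P.natDegree + 1), P.coeff c' *
              ((∑ k ∈ Icc 1 ⌊M / ((c * g : ℕ) : ℝ)⌋₊, (if k.Coprime (c * g) then W k else 0) * (k.divisors.card : ℝ) *
                Real.log (M / ((c * g : ℕ) : ℝ) / k) ^ (c' + r₁)) / Real.log M ^ c')) *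
            (∑ c' ∈ Finset.range (P.natDegree + 1), P.coeff c' *
              ((∑ k ∈ Icc 1 ⌊M / ((c * g : ℕ) : ℝ)⌋₊, (if k.Coprime (c * g) then W k else 0) * (k.divisors.card : ℝ) *
                Real.log (M / ((c * g : ℕ) : ℝ) / k) ^ (c' + r₂)) / Real.log M ^ c'))))| ≤
        Ct (t + 1) * Xe := by
      rw [hXe, ← mul_div_assoc]; exact h
    rw [abs_mul, abs_mul, abs_pow, abs_neg, abs_one, one_pow, mul_one,
      abs_of_nonneg (by positivity : (0 : ℝ) ≤ (p.choose (t + 1) : ℝ)), mul_assoc]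
    exact mul_le_mul_of_nonneg_left h' (by positivity)

end Summit.Parity.GeneralizedHardyLittlewood.Theorems.MomentsBeyondDiagonal.DiagKernel

end
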